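import Literature.AlgebraicGeometry.Resolution.HironakaDirectrixQuadratic
import Literature.AlgebraicGeometry.Resolution.HironakaDirectrixPolar
import Literature.RingTheory.MvPolynomial.DirectrixLinForm
import Mathlib.Algebra.CharP.Two
import Mathlib.Algebra.CharP.Algebra
import HarnessLib

/-!
# [OURS · L1 W4.2] E2 chart calculus, brick 1: QUADRATIC FORMS IN CHARACTERISTIC TWO — `τ ≤ 1` over a field kills the cross terms, and a
# cross-free (diagonal) form with `τ = 2` is `c · (M₁² + λ M₂²)`, `λ ∉ κ²` (the E2 normal form of the initial form)
# (crux chain w42, cell k2 `T3insep` at `p = 2`; `--supports stmt-ResolutionOfSingularities-19249`)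

OURS (cell res-hironaka, slot W4.2, seat res-D-pv-042; OWN OBJECT TUO 15:58Z «(N1)(ii) E2 normal form»); NOT a statement of [Hironaka2017]
nor of [CossartJannsenSaito2020] / [CossartPiltant2008]. AI-drafted, weaker than expert review. PROOF file, def-free, fact-free; linear algebra
over the tree's Hironaka directrix `Literature.AlgebraicGeometry.Resolution.{invarianceSpace, directrix, hironakaTau}` (`𝕎(S)`, `T(S)`,
`τ(S) = d − dim 𝕎(S)`).

Setting: `κ` a field of characteristic `2`, `F ∈ κ[Y₁,…,Y_d]` a quadratic FORM, `F = Σ aᵢYᵢ² + Σ_{i<j} b_{ij} YᵢYⱼ`.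
* §1 `coeff_add_single_eq_zero_of_hironakaTau_le_one` — if `τ_κ({F}) ≤ 1` then every cross coefficient `b_{ij}` vanishes (if `b_{ij} ≠ 0` the
  partials `∂ᵢF`, `∂ⱼF` are independent — `∂ᵢF` has no `Yᵢ` term in characteristic two — so `τ ≥ 2` by the polar bound
  `card_le_hironakaTau_of_linearIndependent_pderiv`).  Read over `κ̄` (where `τ = d − ē`): an inseparable initial form (`ē = d − 1`) is
  DIAGONAL, `F = Σ aᵢ Yᵢ²`, over `κ` itself.
* §2 diagonal forms: all partials vanish, `F(w) = Σ aᵢwᵢ²`, `𝕎({F}) = {w | Σ aᵢ wᵢ² = 0}` (via `mem_invarianceSpace_iff_of_isHomogeneous_two`).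
* §3 `exists_normalForm_of_hironakaTau_eq_two` — a diagonal quadratic form with `τ_κ({F}) = 2` is `c·(M₁² + λM₂²)` for independent linear forms
  `M₁, M₂`, `c ≠ 0` and `λ ∉ κ²` (complement of the codimension-two subspace `𝕎`; additivity `F(v + w) = F(v) + F(w)` of diagonal forms in
  characteristic two); §4 both together: the initial form of an E2 stage (`e = 2 < 3 = ē`, embedding dimension `4`) is `c·(x² + λy²)`.
-/

noncomputable section

set_option linter.dupNamespace false

open scoped Classical
open MvPolynomial Literature.AlgebraicGeometry.Resolution
open Literature.RingTheory.MvPolynomial (linForm)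

namespace Summit.ResolutionOfSingularities.ResolutionOfSingularities.Cruxes.SigmaMaxModifications.IdeasL1C6

universe u

variable {κ : Type u} [Field κ] {d : ℕ}

/-! ## §0. Exponents of degree two -/

/-- Splitting off one non-zero coordinate of an exponent. [folklore] -/
theorem exists_single_add_of_ne_zero {m : Fin d →₀ ℕ} (hne : m ≠ 0) :
    ∃ (i : Fin d) (m' : Fin d →₀ ℕ), m i ≠ 0 ∧ m' i = 0 ∧ m = Finsupp.single i (m i) + m' ∧ m'.degree + m i = m.degree := by
  obtain ⟨i, hi⟩ := Finsupp.ne_iff.mp hne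
  simp only [Finsupp.coe_zero, Pi.zero_apply] at hi
  refine ⟨i, m - Finsupp.single i (m i), hi, by simp, ?_, ?_⟩
  · ext l
    by_cases hl : l = i
    · subst hl; simp
    · simp
  · have h : m = Finsupp.single i (m i) + (m - Finsupp.single i (m i)) := by
      ext l
      by_cases hl : l = i
      · subst hl; simp
      · simp
    have := congrArg Finsupp.degree h
    rw [map_add, Finsupp.degree_single] at this
    omega

/-- An exponent of degree `2` is `2eᵢ` or `eᵢ + eⱼ` with `i ≠ j`. [folklore] -/
theorem exists_eq_of_degree_eq_two {m : Fin d →₀ ℕ} (hm : m.degree = 2) :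
    (∃ i, m = Finsupp.single i 2) ∨ ∃ i j, i ≠ j ∧ m = Finsupp.single i 1 + Finsupp.single j 1 := by
  have hne : m ≠ 0 := by rintro rfl; simp at hm
  obtain ⟨i, m', hi, hm'i, hsplit, hdeg⟩ := exists_single_add_of_ne_zero hne
  rw [hm] at hdeg
  have hle : m i ≤ 2 := by omega
  rcases Nat.lt_or_ge (m i) 2 with h1 | h2
  · -- `m i = 1`: `m'` has degree `1`, so `m' = single j 1` with `j ≠ i`
    have hmi : m i = 1 := by omega
    have hd1 : m'.degree = 1 := by omega
    have hne' : m' ≠ 0 := by rintro rfl; simp at hd1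
    obtain ⟨j, m'', hj, -, hsplit', hdeg'⟩ := exists_single_add_of_ne_zero hne'
    rw [hd1] at hdeg'
    have hmj : m' j = 1 := by omega
    have hd0 : m''.degree = 0 := by omega
    have hm0 : m'' = 0 := (Finsupp.degree_eq_zero_iff _).mp hd0
    rw [hmj, hm0, add_zero] at hsplit'
    right
    refine ⟨i, j, ?_, by rw [hsplit, hmi, hsplit']⟩
    rintro rfl
    rw [hsplit'] at hm'i
    simp at hm'i
  · -- `m i = 2`: `m' = 0`
    have hmi : m i = 2 := le_antisymm hle h2
    have hd0 : m'.degree = 0 := by omega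
    have hm0 : m' = 0 := (Finsupp.degree_eq_zero_iff _).mp hd0
    left
    exact ⟨i, by rw [hsplit, hmi, hm0, add_zero]⟩

/-! ## §1. `τ ≤ 1` kills the cross terms (characteristic two) -/

/-- Coefficients of a partial derivative on linear monomials: `[Yⱼ](∂ᵢF) = b_{ij}` for `i ≠ j`. [folklore] -/
theorem coeff_single_pderiv_of_ne (F : MvPolynomial (Fin d) κ) {i j : Fin d} (hij : i ≠ j) :
    coeff (Finsupp.single j 1) (pderiv i F) = coeff (Finsupp.single i 1 + Finsupp.single j 1) F := by
  rw [coeff_pderiv, Finsupp.single_apply, if_neg (Ne.symm hij), add_comm (Finsupp.single j 1)]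
  simp

/-- In characteristic two `[Yᵢ](∂ᵢF) = 2aᵢ = 0`. [folklore] -/
theorem coeff_single_pderiv_self [CharP κ 2] (F : MvPolynomial (Fin d) κ) (i : Fin d) :
    coeff (Finsupp.single i 1) (pderiv i F) = 0 := by
  rw [coeff_pderiv, Finsupp.single_eq_same]
  have h2 : ((1 : ℕ) : κ) + 1 = 0 := by
    rw [Nat.cast_one, one_add_one_eq_two]; exact CharTwo.two_eq_zero
  rw [h2, mul_zero]

/-- **§1.** For a field `κ` of characteristic two and any `F ∈ κ[Y]`: if Hironaka's `τ_κ({F}) ≤ 1` then every cross coefficient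
`[YᵢYⱼ]F` (`i ≠ j`) vanishes — otherwise `∂ᵢF ∌ Yᵢ`, `∂ᵢF ∋ b_{ij}Yⱼ`, `∂ⱼF ∋ b_{ij}Yᵢ` are two independent partials and `τ ≥ 2` by the polar
bound `card_le_hironakaTau_of_linearIndependent_pderiv`. [OURS · L1 W4.2 · k2] [folklore] -/
theorem coeff_add_single_eq_zero_of_hironakaTau_le_one [CharP κ 2] {F : MvPolynomial (Fin d) κ}
    (hτ : hironakaTau κ ({F} : Set (MvPolynomial (Fin d) κ)) ≤ 1) {i j : Fin d} (hij : i ≠ j) :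
    coeff (Finsupp.single i 1 + Finsupp.single j 1) F = 0 := by
  by_contra hb
  have hlin : LinearIndependent κ (fun t : Fin 2 => pderiv (![i, j] t) F) := by
    rw [Fintype.linearIndependent_iff]
    intro g hg
    rw [Fin.sum_univ_two] at hg
    simp only [Matrix.cons_val_zero, Matrix.cons_val_one] at hg
    have hi := congrArg (coeff (Finsupp.single i 1)) hg
    have hj := congrArg (coeff (Finsupp.single j 1)) hg
    simp only [coeff_add, coeff_smul, smul_eq_mul, coeff_zero, coeff_single_pderiv_self,
      coeff_single_pderiv_of_ne F hij, coeff_single_pderiv_of_ne F (Ne.symm hij), mul_zero, zero_add, add_zero] at hi hj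
    rw [add_comm (Finsupp.single j 1)] at hi
    have hg1 : g 1 = 0 := (mul_eq_zero.mp hi).resolve_right hb
    have hg0 : g 0 = 0 := (mul_eq_zero.mp hj).resolve_right hb
    intro t
    fin_cases t
    · exact hg0
    · exact hg1
  have h2 := card_le_hironakaTau_of_linearIndependent_pderiv κ F ![i, j] hlin
  simp only [Fintype.card_fin] at h2
  omega

/-! ## §2. Diagonal (cross-free) quadratic forms in characteristic two -/

section Diagonal

variable [CharP κ 2] {F : MvPolynomial (Fin d) κ} (hF : F.IsHomogeneous 2)
  (hcross : ∀ i j : Fin d, i ≠ j → coeff (Finsupp.single i 1 + Finsupp.single j 1) F = 0)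
include hF hcross

/-- All partials of a cross-free quadratic form vanish in characteristic two. [folklore] -/
theorem pderiv_eq_zero_of_cross_eq_zero (l : Fin d) : pderiv l F = 0 := by
  ext m
  rw [coeff_zero, coeff_pderiv]
  by_cases hm : (m + Finsupp.single l 1).degree = 2
  · rcases exists_eq_of_degree_eq_two hm with ⟨i, hi⟩ | ⟨i, j, hij, hij'⟩
    · -- `m + e_l = 2 e_i` forces `i = l`, `m = e_l`: the factor `m l + 1 = 2 = 0`
      by_cases hil : i = l
      · subst hil
        have hml : m i = 1 := by
          have h1 := DFunLike.congr_fun hi i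
          simp only [Finsupp.coe_add, Pi.add_apply, Finsupp.single_eq_same] at h1
          omega
        rw [hml]
        have h2 : ((1 : ℕ) : κ) + 1 = 0 := by
          rw [Nat.cast_one, one_add_one_eq_two]; exact CharTwo.two_eq_zero
        rw [h2, mul_zero]
      · exfalso
        have h1 := DFunLike.congr_fun hi l
        rw [Finsupp.coe_add, Pi.add_apply, Finsupp.single_eq_same, Finsupp.single_apply, if_neg hil] at h1
        omega
    · rw [hij', hcross i j hij, zero_mul]
  · rw [hF.coeff_eq_zero hm, zero_mul]

omit [CharP κ 2] in
/-- A cross-free quadratic form is DIAGONAL: `F = Σᵢ aᵢ Yᵢ²`, `aᵢ = [Yᵢ²]F`. [folklore] -/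
theorem eq_sum_C_mul_X_sq_of_cross_eq_zero : F = ∑ i, C (coeff (Finsupp.single i 2) F) * X i ^ 2 := by
  ext m
  rw [coeff_sum]
  simp only [coeff_C_mul, coeff_X_pow]
  by_cases hm : m.degree = 2
  · rcases exists_eq_of_degree_eq_two hm with ⟨i, rfl⟩ | ⟨i, j, hij, rfl⟩
    · rw [Finset.sum_eq_single i]
      · rw [if_pos rfl, mul_one]
      · intro i' _ hi'
        rw [if_neg, mul_zero]
        intro h
        exact hi' ((Finsupp.single_left_inj (by norm_num)).mp h)
      · intro h; exact absurd (Finset.mem_univ i) h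
    · rw [hcross i j hij]
      symm
      refine Finset.sum_eq_zero fun i' _ => ?_
      rw [if_neg, mul_zero]
      intro h
      have h1 := DFunLike.congr_fun h i'
      have h2 := DFunLike.congr_fun h i
      simp only [Finsupp.single_eq_same, Finsupp.coe_add, Pi.add_apply, Finsupp.single_apply] at h1 h2
      split_ifs at h1 h2 <;> omega
  · rw [hF.coeff_eq_zero hm]
    symm
    refine Finset.sum_eq_zero fun i' _ => ?_
    rw [if_neg, mul_zero]
    rintro rfl
    exact hm (by rw [Finsupp.degree_single])

omit [CharP κ 2] in
/-- Its values: `F(w) = Σᵢ aᵢ wᵢ²`. [folklore] -/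
theorem eval_eq_sum_of_cross_eq_zero (w : Fin d → κ) : eval w F = ∑ i, coeff (Finsupp.single i 2) F * w i ^ 2 := by
  conv_lhs => rw [eq_sum_C_mul_X_sq_of_cross_eq_zero hF hcross]
  simp [map_sum, eval_C, eval_X]

/-- **The invariance space of a diagonal quadratic form in characteristic two** is the zero set of the additive map `w ↦ Σ aᵢwᵢ²`:
`𝕎({F}) = {w | Σᵢ aᵢ wᵢ² = 0}` (the tree's `mem_invarianceSpace_iff_of_isHomogeneous_two`; the polar condition is void since all partials
vanish). [folklore] -/
theorem mem_invarianceSpace_iff_of_cross_eq_zero (w : Fin d → κ) :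
    w ∈ invarianceSpace κ ({F} : Set (MvPolynomial (Fin d) κ)) ↔ ∑ i, coeff (Finsupp.single i 2) F * w i ^ 2 = 0 := by
  rw [mem_invarianceSpace_iff_of_isHomogeneous_two κ hF, eval_eq_sum_of_cross_eq_zero hF hcross]
  simp [pderiv_eq_zero_of_cross_eq_zero hF hcross]

end Diagonal

/-! ## §3. The normal form of a diagonal quadratic form with `τ = 2` -/

section NormalForm

variable [CharP κ 2]

/-- In characteristic two the square of a linear form is diagonal: `(Σ sᵢYᵢ)² = Σ sᵢ² Yᵢ²`. [folklore] -/
theorem linForm_sq (s : Fin d → κ) : (linForm s : MvPolynomial (Fin d) κ) ^ 2 = ∑ i, C (s i ^ 2) * X i ^ 2 := by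
  have h : (linForm s : MvPolynomial (Fin d) κ) = ∑ i, C (s i) * X i := by
    rw [Literature.RingTheory.MvPolynomial.linForm_eq_sum_C_mul]
  rw [h, sum_pow_char 2]
  refine Finset.sum_congr rfl fun i _ => ?_
  rw [mul_pow, ← map_pow]

/-- The value map `w ↦ Σ aᵢ wᵢ²` is additive in characteristic two. [folklore] -/
theorem sum_mul_sq_add (a v w : Fin d → κ) :
    ∑ i, a i * (v i + w i) ^ 2 = ∑ i, a i * v i ^ 2 + ∑ i, a i * w i ^ 2 := by
  rw [← Finset.sum_add_distrib]
  refine Finset.sum_congr rfl fun i _ => ?_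
  rw [CharTwo.add_sq, mul_add]

omit [CharP κ 2] in
/-- … and twisted-homogeneous: `φ(c·v) = c²·φ(v)`. [folklore] -/
theorem sum_mul_sq_smul (a : Fin d → κ) (c : κ) (v : Fin d → κ) :
    ∑ i, a i * (c * v i) ^ 2 = c ^ 2 * ∑ i, a i * v i ^ 2 := by
  rw [Finset.mul_sum]
  refine Finset.sum_congr rfl fun i _ => ?_
  ring

variable {F : MvPolynomial (Fin d) κ} (hF : F.IsHomogeneous 2)
  (hcross : ∀ i j : Fin d, i ≠ j → coeff (Finsupp.single i 1 + Finsupp.single j 1) F = 0)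
include hF hcross

/-- **§3. THE E2 NORMAL FORM.** A diagonal quadratic form `F = Σ aᵢYᵢ²` over a field `κ` of characteristic two with Hironaka's
`τ_κ({F}) = 2` is `c·(M₁² + λM₂²)` for two linearly independent linear forms `M₁ = Σ sᵢYᵢ`, `M₂ = Σ tᵢYᵢ`, a unit `c` and a NON-SQUARE `λ`.
Proof: `𝕎 = {Σ aᵢwᵢ² = 0}` has codimension `τ = 2`; for a basis `e, f` of a complement and the coordinate functionals `M₁, M₂` of the
decomposition `κ^d = ⟨e⟩ ⊕ ⟨f⟩ ⊕ 𝕎`, additivity gives `Σ aᵢvᵢ² = M₁(v)²·φ(e) + M₂(v)²·φ(f)`; read at the unit vectors this is the coefficient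
identity, `c = φ(e) ≠ 0` because `e ∉ 𝕎`, and `φ(f)/φ(e) = u²` would put `u·e + f` in `𝕎`. [OURS · L1 W4.2 · k2] [folklore] -/
theorem exists_normalForm_of_hironakaTau_eq_two (hτ : hironakaTau κ ({F} : Set (MvPolynomial (Fin d) κ)) = 2) :
    ∃ (s t : Fin d → κ) (c lam : κ), LinearIndependent κ ![s, t] ∧ c ≠ 0 ∧ (∀ u : κ, u ^ 2 ≠ lam) ∧
      F = C c * (linForm s ^ 2 + C lam * linForm t ^ 2) := by
  set a : Fin d → κ := fun i => coeff (Finsupp.single i 2) F with ha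
  let φ : (Fin d → κ) → κ := fun w => ∑ i, a i * w i ^ 2
  have hφ : ∀ w, φ w = ∑ i, a i * w i ^ 2 := fun _ => rfl
  set W := invarianceSpace κ ({F} : Set (MvPolynomial (Fin d) κ)) with hW
  have hmem : ∀ w, w ∈ W ↔ φ w = 0 := fun w => mem_invarianceSpace_iff_of_cross_eq_zero hF hcross w
  have hφadd : ∀ v w, φ (v + w) = φ v + φ w := fun v w => sum_mul_sq_add a v w
  have hφsmul : ∀ (c : κ) (v : Fin d → κ), φ (c • v) = c ^ 2 * φ v := fun c v => by
    simp only [hφ, Pi.smul_apply, smul_eq_mul]; exact sum_mul_sq_smul a c v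
  have hφW : ∀ w ∈ W, φ w = 0 := fun w hw => (hmem w).mp hw
  have hφsingle : ∀ i, φ (Pi.single i 1) = a i := by
    intro i
    rw [hφ, Finset.sum_eq_single i]
    · simp
    · intro j _ hj; simp [hj]
    · intro h; exact absurd (Finset.mem_univ i) h
  -- dimensions: `dim 𝕎 = d - 2`, a complement has dimension `2`
  have hfinW : Module.finrank κ W + 2 = d := by
    have h := hironakaTau_add_finrank_invarianceSpace κ ({F} : Set (MvPolynomial (Fin d) κ))
    rw [hτ] at h
    rw [hW]
    omega
  obtain ⟨Wc, hc⟩ := W.exists_isCompl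
  have hc' : IsCompl Wc W := hc.symm
  have hfinWc : Module.finrank κ Wc = 2 := by
    have h := Submodule.finrank_add_eq_of_isCompl hc
    have hV : Module.finrank κ (Fin d → κ) = d := Module.finrank_fin_fun κ
    omega
  let b : Module.Basis (Fin 2) κ Wc := Module.finBasisOfFinrankEq κ Wc hfinWc
  set e : Fin d → κ := (b 0 : Fin d → κ) with he
  set f : Fin d → κ := (b 1 : Fin d → κ) with hf
  -- the projection onto the complement and the two coordinate functionals
  set π : (Fin d → κ) →ₗ[κ] Wc := Wc.projectionOnto W hc' with hπ
  set μ : Fin 2 → ((Fin d → κ) →ₗ[κ] κ) := fun t => (b.coord t).comp π with hμdef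
  have hμapply : ∀ t v, μ t v = b.coord t (π v) := fun _ _ => rfl
  have hπmem : ∀ v : Fin d → κ, v - (π v : Fin d → κ) ∈ W := by
    intro v
    have h := Submodule.projection_eq_self_sub_projection hc' v
    rw [Submodule.projection_apply, Submodule.projection_apply] at h
    rw [hπ, ← h]
    exact Submodule.coe_mem _
  have hπdecomp : ∀ v : Fin d → κ, (π v : Fin d → κ) = μ 0 v • e + μ 1 v • f := by
    intro v
    have h := b.sum_repr (π v)
    rw [Fin.sum_univ_two] at h
    have h' := congrArg (Submodule.subtype Wc) h.symm
    simp only [map_add, map_smul, Submodule.coe_subtype] at h'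
    rw [hμapply, hμapply, Module.Basis.coord_apply, Module.Basis.coord_apply]
    exact h'
  have hdecomp : ∀ v : Fin d → κ, ∃ w ∈ W, v = μ 0 v • e + μ 1 v • f + w := fun v =>
    ⟨v - (π v : Fin d → κ), hπmem v, by rw [← hπdecomp v]; abel⟩
  -- the value identity
  set α := φ e with hα
  set γ := φ f with hγ
  have hval : ∀ v : Fin d → κ, φ v = (μ 0 v) ^ 2 * α + (μ 1 v) ^ 2 * γ := by
    intro v
    obtain ⟨w, hw, hv⟩ := hdecomp v
    conv_lhs => rw [hv]
    rw [hφadd, hφadd, hφsmul, hφsmul, hφW w hw, add_zero]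
  -- the coordinates at the complement: `μ t (b t') = δ_{t t'}`
  have hμ : ∀ t t' : Fin 2, μ t (b t' : Fin d → κ) = if t' = t then 1 else 0 := by
    intro t t'
    rw [hμapply, hπ, Submodule.projectionOnto_apply_left hc' (b t'), Module.Basis.coord_apply, b.repr_self,
      Finsupp.single_apply]
  -- α ≠ 0
  have hWc_W : ∀ x : Wc, (x : Fin d → κ) ∈ W → x = 0 := by
    intro x hx
    have h : (x : Fin d → κ) ∈ W ⊓ Wc := ⟨hx, x.2⟩
    rw [hc.inf_eq_bot, Submodule.mem_bot] at h
    exact Subtype.ext h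
  have hα0 : α ≠ 0 := by
    intro h0
    have : b 0 = 0 := hWc_W (b 0) ((hmem e).mpr h0)
    exact b.ne_zero 0 this
  -- λ = γ/α is not a square
  have hlam : ∀ u : κ, u ^ 2 ≠ γ / α := by
    intro u hu
    have hzero : φ (u • e + f) = 0 := by
      rw [hφadd, hφsmul, hu, div_mul_cancel₀ γ hα0, CharTwo.add_self_eq_zero]
    have hmemW : (u • b 0 + b 1 : Wc) = 0 := by
      refine hWc_W _ ((hmem _).mpr ?_)
      simpa [he, hf] using hzero
    have hli := b.linearIndependent
    rw [Fintype.linearIndependent_iff] at hli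
    have := hli ![u, 1] (by simpa [Fin.sum_univ_two] using hmemW) 1
    simp at this
  -- the linear forms
  refine ⟨fun i => μ 0 (Pi.single i 1), fun i => μ 1 (Pi.single i 1), α, γ / α, ?_, hα0, hlam, ?_⟩
  · -- independence of `s, t`
    rw [Fintype.linearIndependent_iff]
    intro g hg
    have hψ : (g 0 • μ 0 + g 1 • μ 1 : (Fin d → κ) →ₗ[κ] κ) = 0 := by
      apply LinearMap.pi_ext'
      intro i
      ext
      have h := congrFun hg i
      simp only [Fin.sum_univ_two, Matrix.cons_val_zero, Matrix.cons_val_one, Pi.add_apply, Pi.smul_apply, smul_eq_mul,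
        Pi.zero_apply] at h
      simp only [LinearMap.coe_comp, LinearMap.coe_single, Function.comp_apply, LinearMap.add_apply, LinearMap.smul_apply,
        smul_eq_mul, LinearMap.zero_apply]
      convert h using 2
    intro t
    fin_cases t
    · have h := LinearMap.congr_fun hψ e
      simp only [LinearMap.add_apply, LinearMap.smul_apply, smul_eq_mul, LinearMap.zero_apply, he, hμ] at h
      simpa using h
    · have h := LinearMap.congr_fun hψ f
      simp only [LinearMap.add_apply, LinearMap.smul_apply, smul_eq_mul, LinearMap.zero_apply, hf, hμ] at h
      simpa using h
  · -- the coefficient identity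
    rw [mul_add, ← mul_assoc, ← map_mul, mul_div_cancel₀ γ hα0, linForm_sq, linForm_sq, Finset.mul_sum, Finset.mul_sum,
      ← Finset.sum_add_distrib]
    conv_lhs => rw [eq_sum_C_mul_X_sq_of_cross_eq_zero hF hcross]
    refine Finset.sum_congr rfl fun i _ => ?_
    rw [← mul_assoc, ← mul_assoc, ← map_mul, ← map_mul, ← add_mul, ← map_add]
    congr 2
    have h := hval (Pi.single i 1)
    rw [hφsingle] at h
    rw [show coeff (Finsupp.single i 2) F = a i from rfl, h]; ring

end NormalForm

/-! ## §4. The E2 normal form of an inseparable initial form -/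

/-- **THE E2 NORMAL FORM OF THE INITIAL FORM.** Let `κ` be a field of characteristic two, `F ∈ κ[Y₁,…,Y_d]` a quadratic form with
Hironaka's `τ_κ({F}) = 2` (directrix of dimension `e = d − 2`) which becomes `τ ≤ 1` over some field extension `L ⊇ κ` (`ē ≥ d − 1`, e.g.
`L = κ̄`: the INSEPARABLE case `e < ē`).  Then `F = c·(M₁² + λM₂²)` with `M₁, M₂` independent linear forms over `κ`, `c ≠ 0` and `λ ∉ κ²` —
for `d = 4` the initial form of an E2 stage is `c·(x² + λy²)`.  (§1 over `L` kills the cross terms, which are defined over `κ`; then §3.)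
[OURS · L1 W4.2 · k2 · E2 chart calculus, brick 1] [folklore] -/
theorem exists_normalForm_of_hironakaTau_eq_two_of_extension [CharP κ 2] {F : MvPolynomial (Fin d) κ} (hF : F.IsHomogeneous 2)
    (hτ : hironakaTau κ ({F} : Set (MvPolynomial (Fin d) κ)) = 2)
    (L : Type u) [Field L] [Algebra κ L]
    (hτL : hironakaTau L ({MvPolynomial.map (algebraMap κ L) F} : Set (MvPolynomial (Fin d) L)) ≤ 1) :
    ∃ (s t : Fin d → κ) (c lam : κ), LinearIndependent κ ![s, t] ∧ c ≠ 0 ∧ (∀ u : κ, u ^ 2 ≠ lam) ∧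
      F = C c * (linForm s ^ 2 + C lam * linForm t ^ 2) := by
  haveI : CharP L 2 := charP_of_injective_algebraMap (algebraMap κ L).injective 2
  refine exists_normalForm_of_hironakaTau_eq_two hF (fun i j hij => ?_) hτ
  have h := coeff_add_single_eq_zero_of_hironakaTau_le_one hτL hij
  rw [coeff_map] at h
  exact (map_eq_zero_iff (algebraMap κ L) (algebraMap κ L).injective).mp h

end Summit.ResolutionOfSingularities.ResolutionOfSingularities.Cruxes.SigmaMaxModifications.IdeasL1C6

end
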